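import Summits.CriticalPhenomena.PercolationContinuityZ3.Theorems.PercNearOneGluingNoHeavyQuantGluedForestSDEC
import Summits.CriticalPhenomena.PercolationContinuityZ3.Theorems.PercNearOneGluingNoHeavyQuantGluedChildrenThree
import HarnessLib

/-!
# QUANT lane R8, T-DEC: the GLUED SIBLING `R^lo[q](R^K[g])` of a general shape — law facts, its forced same-mean mixture into the big heavy blob
# `blob_{lo+K}(m/(lo+K))` and the far-giant piece `S((m−lo)/K)`, the blob step of size `lo+K`, and the lone sibling's SDEC (census-1 gen 31;
# shape-general form of census-1 g30's `gate_gluedChild_eq_mix` / `sdec_gluedChild` / `sdec_blob3_step`)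

builds on p205010 (kernel theorem, internal audit signed; external expert review pending)

Support file (`--supports stmt-CriticalPhenomena-4575`), QUANT lane seat prim-quant-census-1 (gen 31); memo
`run/shared/lean/prim/quant/prim-quant-census-1/g31/HUB-GENERAL-G31.md` §3.  Theorems only (no definitions), standard axioms, no sorries.  Uses arm-1 g49's
`gluedSib_sdec` / `gluedSib_rho_apply` (`…QuantGluedForestSDEC`: the sub-forest law `slice δ_lo K g = {lo: 1−g, lo+K: g}` is SDEC at every floor `≤ g`),
`sdec_slice'`, `lconv_gate_point_eq_slice`, `lconv_laws`, `gate_laws`.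

* `sp_laws` (the piece `S(γ) = {lo: 1−γ, lo+K: γ}`: mass `1`, mean `lo + Kγ`), `gateBlob_laws` (`gate δ_B s`: mean `B·s`), **`sdec_blob_step`** (an SDEC
  affordable law convolved with a heavy blob `gate δ_B s`, `x ≤ s ≤ 1`, stays SDEC — `sdec_slice'` — with its law facts), `shapeSib_laws`
  (`gate S(g) q`: mean `m = q(lo + Kg)`), `shapeSib_params` (`lo < K ≤ 2lo`, `m ≥ 2lo`: `α = B(1−q)/(B−m) ∈ [0,1]`, blob gate `m/B ∈ [2lo/B, 1)`,
  piece gate `γ = (m−lo)/K` with `lo ≤ Kγ`, `1/2 ≤ γ < 1`);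
* **`gate_shapeSib_eq_mix`** — THE FORCED MIXTURE `gate S(g) q = α·gate δ_B (m/B) + (1−α)·S(γ)` pointwise (`B = lo+K`);
* **`sdec_shapeSib`** — one glued sibling `gate S(g) q` (`g < 1`) is SDEC at every floor `0 < x ≤ qg` (`gluedSib_sdec` at `x/q`, then the root gate).

HONEST STATUS.  Tools; `SiblingStep`, `GluedDominated'`, `SDECConvClosed`, `FarTreeRow` OPEN; RATE class (log\*) / honest sentence of
`run/shared/lean/prim/quant/README.md` unchanged.  [this work].  Nothing here is cited as a published result.  The gluing rows served
[cite: KozmaNitzan2024, Conjecture 3 (p. 15)]; product measure [cite: Grimmett1999, §1.3 p. 10].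
-/

noncomputable section

open scoped BigOperators

namespace Summit.CriticalPhenomena.PercolationContinuityZ3.Theorems
namespace Quant
namespace LawDec

open Finset

/-- the point mass `δ_K` -/
local notation3 "δ[" K "]" => (fun k : ℕ => if k = (K : ℕ) then (1 : ℝ) else 0)

/-- the FAR-GIANT PIECE / sub-forest law of shape `(lo, K)`: `S(γ) = {lo: 1−γ, lo+K: γ}` -/
local notation3 "SP[" lo ", " K ", " a "]" => (fun h : ℕ => (1 - (a : ℝ)) * (if h = (lo : ℕ) then (1 : ℝ) else 0) +
  (a : ℝ) * (if h = (lo : ℕ) + (K : ℕ) then (1 : ℝ) else 0))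

/-! ### Law facts -/

/-- law facts of the piece `S(γ)` (`0 ≤ γ ≤ 1`): nonnegative, vanishing above `lo+K`, mass `1`, mean `lo + Kγ`. [this work] -/
theorem sp_laws (lo K : ℕ) {γ : ℝ} (h0 : 0 ≤ γ) (h1 : γ ≤ 1) :
    (∀ h, 0 ≤ SP[lo, K, γ] h) ∧ (∀ h, lo + K < h → SP[lo, K, γ] h = 0) ∧ ∑ h ∈ Finset.range (lo + K + 1), SP[lo, K, γ] h = 1 ∧
      ∑ h ∈ Finset.range (lo + K + 1), (h : ℝ) * SP[lo, K, γ] h = (lo : ℝ) + K * γ := by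
  refine ⟨fun h => ?_, fun h hh => ?_, ?_, ?_⟩
  · dsimp only; split_ifs <;> nlinarith
  · dsimp only; rw [if_neg (by omega), if_neg (by omega)]; ring
  · simp only [Finset.sum_add_distrib, ← Finset.mul_sum, Finset.sum_ite_eq', Finset.mem_range]
    rw [if_pos (by omega), if_pos (by omega)]; ring
  · have e : ∀ h : ℕ, (h : ℝ) * SP[lo, K, γ] h
        = (1 - γ) * (if h = lo then ((lo : ℕ) : ℝ) else 0) + γ * (if h = lo + K then (((lo + K : ℕ)) : ℝ) else 0) := by
      intro h; dsimp only
      by_cases h1 : h = lo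
      · by_cases h2 : h = lo + K
        · have hK : K = 0 := by omega
          rw [if_pos h1, if_pos h2, if_pos h1, if_pos h2, h1, hK]; push_cast; ring
        · rw [if_pos h1, if_neg h2, if_pos h1, if_neg h2, h1]; ring
      · by_cases h2 : h = lo + K
        · rw [if_neg h1, if_pos h2, if_neg h1, if_pos h2, h2]; ring
        · rw [if_neg h1, if_neg h2, if_neg h1, if_neg h2]; ring
    simp only [e, Finset.sum_add_distrib, ← Finset.mul_sum, Finset.sum_ite_eq', Finset.mem_range]
    rw [if_pos (by omega), if_pos (by omega)]; push_cast; ring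

/-- law facts of the heavy blob `gate δ_B s` (`0 ≤ s ≤ 1`): mass `1`, mean `B·s`. [this work] -/
theorem gateBlob_laws (B : ℕ) {s : ℝ} (h0 : 0 ≤ s) (h1 : s ≤ 1) :
    (∀ h, 0 ≤ gate δ[B] s h) ∧ (∀ h, B < h → gate δ[B] s h = 0) ∧ ∑ h ∈ Finset.range (B + 1), gate δ[B] s h = 1 ∧
      ∑ h ∈ Finset.range (B + 1), (h : ℝ) * gate δ[B] s h = (B : ℝ) * s := by
  have d0 : ∀ h, 0 ≤ δ[B] h := fun h => by dsimp only; split_ifs <;> norm_num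
  have dM : ∀ h, B < h → δ[B] h = 0 := fun h hh => by dsimp only; rw [if_neg (by omega)]
  have d1 : ∑ h ∈ Finset.range (B + 1), δ[B] h = 1 := by
    rw [Finset.sum_ite_eq']; rw [if_pos (Finset.mem_range.2 (by omega))]
  obtain ⟨g0, gM, g1⟩ := gate_laws B δ[B] s h0 h1 d0 dM d1
  refine ⟨g0, gM, g1, ?_⟩
  rw [sum_mul_gate]
  have e : ∀ h : ℕ, (h : ℝ) * δ[B] h = (if h = B then ((B : ℕ) : ℝ) else 0) := by
    intro h; dsimp only; split_ifs with hh
    · rw [hh, mul_one]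
    · rw [mul_zero]
  simp only [e, Finset.sum_ite_eq', Finset.mem_range]
  rw [if_pos (by omega)]; ring

/-- **the heavy blob step of size `B`**: an SDEC top-affordable probability law `μ` on `{0..M}` convolved with `gate δ_B s`, `x ≤ s ≤ 1`, is SDEC on
`{0..M+B}` (`sdec_slice'`), with its law facts (mean `m + B·s`). [this work] -/
theorem sdec_blob_step (B : ℕ) {x s m : ℝ} {M : ℕ} {μ : ℕ → ℝ} (hx0 : 0 < x) (hx1 : x < 1) (hxs : x ≤ s) (hs1 : s ≤ 1)
    (μ0 : ∀ h, 0 ≤ μ h) (μM : ∀ h, M < h → μ h = 0) (μ1 : ∑ h ∈ Finset.range (M + 1), μ h = 1)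
    (μm : ∑ h ∈ Finset.range (M + 1), (h : ℝ) * μ h = m) (hta : x * (M : ℝ) ≤ m) (hS : SDEC x M μ) :
    (∀ h, 0 ≤ lconv M B μ (gate δ[B] s) h) ∧ (∀ h, M + B < h → lconv M B μ (gate δ[B] s) h = 0) ∧
      ∑ h ∈ Finset.range (M + B + 1), lconv M B μ (gate δ[B] s) h = 1 ∧
      ∑ h ∈ Finset.range (M + B + 1), (h : ℝ) * lconv M B μ (gate δ[B] s) h = m + (B : ℝ) * s ∧
      SDEC x (M + B) (lconv M B μ (gate δ[B] s)) := by
  obtain ⟨e0, _, e1, emean⟩ := gateBlob_laws B (hx0.le.trans hxs) hs1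
  obtain ⟨B0, BM, B1, Bmean⟩ := lconv_laws μ0 μ1 μm e0 e1 emean
  refine ⟨B0, BM, B1, Bmean, ?_⟩
  rw [lconv_gate_point_eq_slice M B μ s μM]
  exact sdec_slice' x s M B μ hx0 hx1 hxs hs1 μ0 μM μ1 (by rw [μm]; exact hta) hS

/-- law facts of the glued sibling `gate S(g) q` (`0 ≤ q, g ≤ 1`): mass `1`, mean `q(lo + Kg)`. [this work] -/
theorem shapeSib_laws (lo K : ℕ) {q g : ℝ} (hq0 : 0 ≤ q) (hq1 : q ≤ 1) (hg0 : 0 ≤ g) (hg1 : g ≤ 1) :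
    (∀ h, 0 ≤ gate SP[lo, K, g] q h) ∧ (∀ h, lo + K < h → gate SP[lo, K, g] q h = 0) ∧
      ∑ h ∈ Finset.range (lo + K + 1), gate SP[lo, K, g] q h = 1 ∧
      ∑ h ∈ Finset.range (lo + K + 1), (h : ℝ) * gate SP[lo, K, g] q h = q * ((lo : ℝ) + K * g) := by
  obtain ⟨c0, cM, c1, cmean⟩ := sp_laws lo K hg0 hg1
  obtain ⟨g0, gM, g1⟩ := gate_laws (lo + K) SP[lo, K, g] q hq0 hq1 c0 cM c1
  exact ⟨g0, gM, g1, by rw [sum_mul_gate, cmean]⟩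

/-- parameter facts of a glued sibling `R^lo[q](R^K[g])` with `lo < K ≤ 2lo` and `m = q(lo + Kg) ≥ 2lo`: `0 < B − m` (`B = lo+K`), the mixture weight
`α = B(1−q)/(B−m) ∈ [0,1]`, the blob gate `m/B ∈ [2lo/B, 1)` with `x ≤ m/B`, the piece gate `γ = (m−lo)/K` with `lo ≤ Kγ`, `1/2 ≤ γ < 1`,
`x·B ≤ lo + Kγ`. [this work] -/
theorem shapeSib_params (lo K : ℕ) (hloK : lo < K) (hK2 : K ≤ 2 * lo) {q g x : ℝ} (hq0 : 0 < q) (hq1 : q < 1) (hg1 : g < 1)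
    (hm : 2 * (lo : ℝ) ≤ q * ((lo : ℝ) + K * g)) (hx : x ≤ q * g) :
    0 < ((lo : ℝ) + K) - q * ((lo : ℝ) + K * g) ∧
      0 ≤ ((lo : ℝ) + K) * (1 - q) / (((lo : ℝ) + K) - q * ((lo : ℝ) + K * g)) ∧
      ((lo : ℝ) + K) * (1 - q) / (((lo : ℝ) + K) - q * ((lo : ℝ) + K * g)) ≤ 1 ∧
      2 * (lo : ℝ) ≤ ((lo : ℝ) + K) * (q * ((lo : ℝ) + K * g) / ((lo : ℝ) + K)) ∧
      q * ((lo : ℝ) + K * g) / ((lo : ℝ) + K) < 1 ∧ x ≤ q * ((lo : ℝ) + K * g) / ((lo : ℝ) + K) ∧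
      (lo : ℝ) ≤ K * ((q * ((lo : ℝ) + K * g) - lo) / K) ∧ 1 / 2 ≤ (q * ((lo : ℝ) + K * g) - lo) / K ∧
      (q * ((lo : ℝ) + K * g) - lo) / K < 1 ∧ x * ((lo : ℝ) + K) ≤ lo + K * ((q * ((lo : ℝ) + K * g) - lo) / K) := by
  have hlo : 1 ≤ lo := by omega
  have hloR : (1 : ℝ) ≤ lo := by exact_mod_cast hlo
  have hKR : (lo : ℝ) < K := by exact_mod_cast hloK
  have hK2R : (K : ℝ) ≤ 2 * lo := by exact_mod_cast hK2
  have hK0 : (0 : ℝ) < K := by linarith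
  have hB0 : (0 : ℝ) < (lo : ℝ) + K := by linarith
  set m : ℝ := q * ((lo : ℝ) + K * g) with hmdef
  have hKg : (K : ℝ) * g < K := by nlinarith
  have hmB : m < (lo : ℝ) + K := by
    have : m < (lo : ℝ) + K * g := by rw [hmdef]; nlinarith
    linarith
  have hD : 0 < ((lo : ℝ) + K) - m := by linarith
  have hmq : m ≤ ((lo : ℝ) + K) * q := by rw [hmdef]; nlinarith
  refine ⟨hD, div_nonneg (by nlinarith) hD.le, ?_, ?_, ?_, ?_, ?_, ?_, ?_, ?_⟩
  · rw [div_le_one hD]; nlinarith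
  · rw [mul_div_cancel₀ _ hB0.ne']; exact hm
  · rw [div_lt_one hB0]; exact hmB
  · rw [le_div_iff₀ hB0]
    have h1 : q * g * ((lo : ℝ) + K) ≤ m := by rw [hmdef]; nlinarith
    have h2 : x * ((lo : ℝ) + K) ≤ q * g * ((lo : ℝ) + K) := mul_le_mul_of_nonneg_right hx hB0.le
    linarith
  · rw [mul_div_cancel₀ _ hK0.ne']; linarith
  · rw [le_div_iff₀ hK0]; linarith
  · rw [div_lt_one hK0]; linarith
  · rw [mul_div_cancel₀ _ hK0.ne']
    have : q * g * ((lo : ℝ) + K) ≤ m := by rw [hmdef]; nlinarith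
    nlinarith

/-! ### The forced mixture -/

/-- algebra of a two-term mixture with weight `α = B(1−q)/(B−m)`: clear the denominator `B − m`. [this work] -/
theorem mix_alg {B m q c₁ c₂ L : ℝ} (hD : B - m ≠ 0) (h : L * (B - m) = B * (1 - q) * c₁ + ((B - m) - B * (1 - q)) * c₂) :
    L = B * (1 - q) / (B - m) * c₁ + (1 - B * (1 - q) / (B - m)) * c₂ := by
  have e : B * (1 - q) / (B - m) * c₁ + (1 - B * (1 - q) / (B - m)) * c₂ = (B * (1 - q) * c₁ + ((B - m) - B * (1 - q)) * c₂) / (B - m) := by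
    field_simp
  rw [e, eq_div_iff hD]
  exact h

/-- **THE FORCED MIXTURE**: `gate S(g) q = α·gate δ_B (m/B) + (1−α)·S((m−lo)/K)` pointwise (`B = lo+K`, `m = q(lo+Kg)`, `α = B(1−q)/(B−m)`;
`1 ≤ lo`, `1 ≤ K`, `q < 1`, `0 ≤ g ≤ 1`). [this work] -/
theorem gate_shapeSib_eq_mix (lo K : ℕ) (hlo : 1 ≤ lo) (hK : 1 ≤ K) {q g : ℝ} (hq1 : q < 1) (hg0 : 0 ≤ g) (hg1 : g ≤ 1) (h : ℕ) :
    gate SP[lo, K, g] q h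
      = ((lo : ℝ) + K) * (1 - q) / (((lo : ℝ) + K) - q * ((lo : ℝ) + K * g)) * gate δ[lo + K] (q * ((lo : ℝ) + K * g) / ((lo : ℝ) + K)) h +
        (1 - ((lo : ℝ) + K) * (1 - q) / (((lo : ℝ) + K) - q * ((lo : ℝ) + K * g))) * SP[lo, K, (q * ((lo : ℝ) + K * g) - lo) / K] h := by
  have hloR : (1 : ℝ) ≤ lo := by exact_mod_cast hlo
  have hKR : (1 : ℝ) ≤ K := by exact_mod_cast hK
  have hB : ((lo : ℝ) + K) ≠ 0 := by linarith
  have hKne : (K : ℝ) ≠ 0 := by linarith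
  have hD : ((lo : ℝ) + K) - q * ((lo : ℝ) + K * g) ≠ 0 := by
    have : q * ((lo : ℝ) + K * g) < (lo : ℝ) + K := by
      by_cases hq : 0 ≤ q
      · have : (K : ℝ) * g ≤ K := by nlinarith
        nlinarith
      · have : q * ((lo : ℝ) + K * g) ≤ 0 := by
          have : 0 ≤ (lo : ℝ) + K * g := by positivity
          nlinarith
        linarith
    linarith
  have hD' : -(q * g * (K : ℝ)) - q * lo + K + lo ≠ 0 := by
    intro h0; apply hD; linarith
  rw [gate_apply, gate_apply]
  dsimp only
  by_cases h0 : h = 0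
  · rw [h0, if_neg (show (0 : ℕ) ≠ lo by omega), if_neg (show (0 : ℕ) ≠ lo + K by omega), if_pos (show (0 : ℕ) = 0 from rfl)]
    refine mix_alg hD ?_
    field_simp
    ring
  · rw [if_neg h0]
    by_cases h1 : h = lo
    · rw [if_pos h1, if_neg (show h ≠ lo + K by omega)]
      refine mix_alg hD ?_
      field_simp
      ring
    · by_cases h2 : h = lo + K
      · rw [if_neg h1, if_pos h2]
        refine mix_alg hD ?_
        field_simp
        ring
      · rw [if_neg h1, if_neg h2]
        ring

/-! ### One glued sibling is SDEC -/

/-- the piece law is arm-1 g49's glued sub-forest law: `S(g) = slice δ_lo K g`. [this work] -/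
theorem sp_eq_slice (lo K : ℕ) (hlo : 1 ≤ lo) (hK : 1 ≤ K) (g : ℝ) : SP[lo, K, g] = slice δ[lo] K g := by
  funext h
  rw [gluedSib_rho_apply lo K hlo hK g h]
  split_ifs <;> ring

/-- **ONE GLUED SIBLING IS SDEC**: `gate S(g) q` is `SDEC x (lo+K)` at every floor `0 < x ≤ qg` (`0 < q < 1`, `g < 1`, `lo, K ≥ 1`). [this work] -/
theorem sdec_shapeSib (lo K : ℕ) (hlo : 1 ≤ lo) (hK : 1 ≤ K) {x q g : ℝ} (hx0 : 0 < x) (hq0 : 0 < q) (hq1 : q < 1) (hg1 : g < 1)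
    (hx : x ≤ q * g) : SDEC x (lo + K) (gate SP[lo, K, g] q) := by
  have hxq : x / q ≤ g := by rw [div_le_iff₀ hq0]; linarith
  have hxq0 : 0 < x / q := div_pos hx0 hq0
  have hxq1 : x / q < 1 := by
    rw [div_lt_one hq0]
    have : q * g < q * 1 := mul_lt_mul_of_pos_left hg1 hq0
    linarith
  have h := gluedSib_sdec lo K hxq0 hxq1 hxq hg1.le
  rw [← sp_eq_slice lo K hlo hK g] at h
  have := sdec_gate h q hq0 hq1.le
  rwa [mul_div_cancel₀ _ hq0.ne'] at this

end LawDec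
end Quant
end Summit.CriticalPhenomena.PercolationContinuityZ3.Theorems
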